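import Summits.QuantumFields.YangMills.Theorems.UV3BranchExpansionHTopSegment
import HarnessLib

/-!
# R3 (cell `ym3-torus`, YM₃ on T³ — a ladder RUNG, NOT d = 4, NOT infinite volume, NOT a mass gap, NOT the Clay problem) —
# **(F-TOP-SEG-WIDE∕REC) hTop FOR ONE SEGMENT ON `SU(2)` AT THE TWO WIDER (H_K) RANGES `L^{d−1} ≤ 25` AND `L^{d−1} ≤ 400`: px8's generic knit
# ✓`UV3BranchExpansionHTopSegment.map_iterFrom_le_exp_smul_of_hw` fed with w8's hypothesis-free ✓`hw_su2_of_pow_le_twentyfive` ∕ ✓`hw_su2_of_pow_le_four_hundred`**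

Width seat `ym-ust-19936-w8` g12 on crux `stmt-QuantumFields-19936` `UnitScaleTilt.HistoryTailL` (`--supports`, helper; THEOREMS ONLY, 0 `def`, 0 `sorry`).
SIBLING of px8 g13's ✓p762747 `UV3BranchExpansionHTopSegment` (§3 there = the `L^{d−1} ≤ 9` instance over ✓`hw_su2_of_pow_le_nine`, i.e. the T³ families at `L = 3`):
the SAME composition at the two wider (H_K) ranges of the n08 lineage — `L^{d−1} ≤ 25` (n08-w3 ✓`…GuardCoreLawSU2Wide.fibre_law_le_su2_wide`, `K⋆⋆ = m⋆⋆⁻¹ + 1`,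
`m⋆⋆ = ((1∕25)·sin 1·(sin(π∕3)∕(π∕3)))³·(sin(π∕3)∕(π∕3))²`; T³: `L ≤ 5`) and `L^{d−1} ≤ 400` (dag-n08-d∕n08-w3 ✓`…SU2Record.fibre_law_le_su2_record`, `K_rec` with `1∕400`;
T³: `L ≤ 20`, which COVERS the record's block sizes `8 ≤ θ.L ≤ 20` that the `≤ 25` row does not) — via w8's ✓p762268 `hw_su2_of_pow_le_twentyfive` ∕
`hw_su2_of_pow_le_four_hundred` and its finiteness letters `one_le_kstar_…_and_ne_top`, `weight_base_ne_top`.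
RECORD CURRENCY (★★OWNER WORDS 84 (2) ∕ 85 (4) ∕ ACK 145): record-independent kinematics of product Haar under print's guarded averaging; SUPPLY-side for the
hTop-class rows of NODE O B3 ∕ Track A's N08 — NOT a 19936 registry row.

HYP-SAT (★★OWNER RULING №42, on the LITERAL T³ families `avT3 = blockAvg expMeanLogSU`, `d = 3`): `hjn : j + n ≤ m + K` = the segment's standing range (the caller's
`j + n = K` by `omega`); `hL : L^{d−1} ≤ 25` ⟺ `L ≤ 5`, resp. `≤ 400` ⟺ `L ≤ 20` — RANGE rows, the T³ members with those block sizes ONLY (for `L ≥ 21` the tree holds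
(H_K) only existentially — n08 g5 ✓`…GuardCoreLawSUN` — NOT supplied, said so); `hh0 : h(δ′) ≠ 0` for every `δ′ > 0` (px13 ✓`haarData_dist1_lt_one_div_ne_zero` at
`δ′ = 1∕21`); `hsmallE`∕`hsmallG` = the two (C′) rows at `x := 2·W.toReal` — NUMBERS: at `L = 5` supplied by px13 g14 ✓`two_mul_kstar_wide_mul_ratio_le_letters` ∘
✓`smallness_T3_L5_of_ennreal_le`; at the record's `8 ≤ L ≤ 20` NOT yet in the tree (exponent `L²−1 ≥ 63` makes them tiny, but they are (C′)∕H's to certify, not asserted here).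

CONTENTS.  ★★★ `map_iterFrom_le_exp_smul_su2_wide` (`L^{d−1} ≤ 25`) · ★★ `map_iterFrom_le_exp_smul_su2_record` (`L^{d−1} ≤ 400`).

HONEST SCOPE.  Two corollaries of px8's ✓`map_iterFrom_le_exp_smul_of_hw` ∘ `exists_traj` and w8's ✓p762268 rows BY NAME ([folklore] bookkeeping); the theorem is hTop for
ONE SEGMENT modulo the two smallness NUMBERS; hTop(F) at `L = 5` ∕ at the record's `L` is the 60-line top file over this (w5-type `…HTopT3L3`), not here; nothing of the
χ record ∕ (O‴χₛ) ∕ EX ∕ `HistoryTailL` (19936) ∕ the rung ∕ d = 4 ∕ a mass gap ∕ Clay is proved.  YM₃ on T³ is rung R3 of the ladder, not the Clay problem.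

References: T. Bałaban, Commun. Math. Phys. **109** (1987) 249–301 [Balaban1987RG1] ((0.4) p. 253); T. Bałaban, Commun. Math. Phys. **102** (1985) 255–275
[Balaban1985UV3] ((2) p. 256).
-/

set_option autoImplicit false

noncomputable section

open MeasureTheory Function
open scoped ENNReal

namespace Summit.QuantumFields.YangMills.Theorems.UV3BranchExpansionHTopSegmentSU2Ranges

open Literature.MathematicalPhysics.QuantumFieldTheory.Balaban1983to89
open Literature.MathematicalPhysics.QuantumFieldTheory.Balaban1983to89.BlockAveraging (blockAvg)
open Literature.MathematicalPhysics.QuantumFieldTheory.Balaban1983to89.T4AvgSensitivity (iterFrom)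
open Literature.MathematicalPhysics.QuantumFieldTheory.Balaban1983to89.ExpMeanLog (expMeanLogSU measurable_expMeanLogSU_E)
open Summit.QuantumFields.YangMills.Theorems.UV3BranchExpansionHTopSegment (exists_traj map_iterFrom_le_exp_smul_of_hw)
open Summit.QuantumFields.YangMills.Theorems.UV3BranchExpansionSocketWeightsSU (hw_su2_of_pow_le_twentyfive hw_su2_of_pow_le_four_hundred
  one_le_kstar_twentyfive_and_ne_top one_le_kstar_four_hundred_and_ne_top weight_base_ne_top)

variable {P : Params} {j n : ℕ}

/-- ★★★ **hTop FOR A SEGMENT ON `SU(2)`, exp-mean-log average, RANGE `L^{d−1} ≤ 25` (T³: `L25`).**  Standing range `j + n ≤ m + K`; `δ′` with `h(δ′) ≠ 0`;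
activity ratio `W := K · h(1∕3+δ′)^{L^{d−1}−1} ∕ h(δ′)` with `K = (ofReal m(1∕25))⁻¹ + 1` VERBATIM the (H_K) constant of ✓`fibre_law_le_su2_wide` (w8's hypothesis-free
✓`hw_su2_of_pow_le_twentyfive`); the two smallness rows at `x := 2·W.toReal` for some `y ∈ (0,1]`, `θ₀ < 1`.  Then
**`(dU_j).map (iterFrom (blockAvg expMeanLogSU) j n) ≤ ofReal (exp (#PBond(j+n)·(2∕(1−θ₀))·(x ∕ y^{(2d−1)(L−1)}))) • dU_{j+n}`** — px8's ✓`map_iterFrom_le_exp_smul_of_hw` ∘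
✓`exists_traj` at this `hw`. At `L = 5`, `δ′ = 1∕21` the rows are px13 g14's ✓`two_mul_kstar_wide_mul_ratio_le_letters` ∘ ✓`smallness_T3_L5_of_ennreal_le`. [cite: Balaban1987RG1, (0.4) p.253; Balaban1985UV3, (2) p.256] -/
theorem map_iterFrom_le_exp_smul_su2_wide (hjn : j + n ≤ P.m + P.K) (hL : P.L ^ (P.d - 1) ≤ 25) (δ' : ℝ)
    (hh0 : (HaarData.haar : Measure (Matrix.specialUnitaryGroup (Fin 2) ℂ)) {g | dist1 g < δ'} ≠ 0)
    {y θ₀ : ℝ} (hy : 0 < y) (hy1 : y ≤ 1) (hθ₀ : θ₀ < 1)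
    (hsmallE : (1 + 2 / (1 - θ₀) * (2 *
        (((ENNReal.ofReal (((1 / 25 : ℝ) * Real.sin 1 * (Real.sin (Real.pi / 3) / (Real.pi / 3))) ^ 3 * (Real.sin (Real.pi / 3) / (Real.pi / 3)) ^ 2))⁻¹ + 1) *
          ((HaarData.haar : Measure (Matrix.specialUnitaryGroup (Fin 2) ℂ)) {g | dist1 g < 1 / 3 + δ'} ^ (P.L ^ (P.d - 1) - 1) /
            (HaarData.haar : Measure (Matrix.specialUnitaryGroup (Fin 2) ℂ)) {g | dist1 g < δ'})).toReal /
        y ^ ((2 * P.d - 1) * (P.L - 1)))) ^ (2 * P.d * P.L ^ P.d) ≤ 2)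
    (hsmallG : (y + 2 / (1 - θ₀) * (2 *
        (((ENNReal.ofReal (((1 / 25 : ℝ) * Real.sin 1 * (Real.sin (Real.pi / 3) / (Real.pi / 3))) ^ 3 * (Real.sin (Real.pi / 3) / (Real.pi / 3)) ^ 2))⁻¹ + 1) *
          ((HaarData.haar : Measure (Matrix.specialUnitaryGroup (Fin 2) ℂ)) {g | dist1 g < 1 / 3 + δ'} ^ (P.L ^ (P.d - 1) - 1) /
            (HaarData.haar : Measure (Matrix.specialUnitaryGroup (Fin 2) ℂ)) {g | dist1 g < δ'})).toReal /
        y ^ ((2 * P.d - 1) * (P.L - 1)))) ^ (P.L - 1) *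
      (1 + 2 * (2 *
        (((ENNReal.ofReal (((1 / 25 : ℝ) * Real.sin 1 * (Real.sin (Real.pi / 3) / (Real.pi / 3))) ^ 3 * (Real.sin (Real.pi / 3) / (Real.pi / 3)) ^ 2))⁻¹ + 1) *
          ((HaarData.haar : Measure (Matrix.specialUnitaryGroup (Fin 2) ℂ)) {g | dist1 g < 1 / 3 + δ'} ^ (P.L ^ (P.d - 1) - 1) /
            (HaarData.haar : Measure (Matrix.specialUnitaryGroup (Fin 2) ℂ)) {g | dist1 g < δ'})).toReal /
        y ^ ((2 * P.d - 1) * (P.L - 1))) / y) ^ ((P.L - 1) * (2 * P.d)) ≤ θ₀) :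
    (fieldMeasure P j (Matrix.specialUnitaryGroup (Fin 2) ℂ)).map
        (iterFrom (fun k => blockAvg (P := P) (j := k) (expMeanLogSU : LoopAverage (Matrix.specialUnitaryGroup (Fin 2) ℂ))) j n) ≤
      ENNReal.ofReal (Real.exp (Fintype.card (PBond P (j + n)) * (2 / (1 - θ₀) * (2 *
        (((ENNReal.ofReal (((1 / 25 : ℝ) * Real.sin 1 * (Real.sin (Real.pi / 3) / (Real.pi / 3))) ^ 3 * (Real.sin (Real.pi / 3) / (Real.pi / 3)) ^ 2))⁻¹ + 1) *
          ((HaarData.haar : Measure (Matrix.specialUnitaryGroup (Fin 2) ℂ)) {g | dist1 g < 1 / 3 + δ'} ^ (P.L ^ (P.d - 1) - 1) /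
            (HaarData.haar : Measure (Matrix.specialUnitaryGroup (Fin 2) ℂ)) {g | dist1 g < δ'})).toReal /
        y ^ ((2 * P.d - 1) * (P.L - 1)))))) •
        fieldMeasure P (j + n) (Matrix.specialUnitaryGroup (Fin 2) ℂ) := by
  obtain ⟨V, hV0, hVs⟩ := exists_traj (P := P) (expMeanLogSU : LoopAverage (Matrix.specialUnitaryGroup (Fin 2) ℂ)) j n
  exact map_iterFrom_le_exp_smul_of_hw (expMeanLogSU : LoopAverage (Matrix.specialUnitaryGroup (Fin 2) ℂ)) j n measurable_expMeanLogSU_E V hV0 hVs hjn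
    (weight_base_ne_top one_le_kstar_twentyfive_and_ne_top.2 (1 / 3 + δ') δ' (P.L ^ (P.d - 1) - 1) hh0)
    (hw_su2_of_pow_le_twentyfive n V hV0 hVs hjn hL δ' hh0) hy hy1 hθ₀ hsmallE hsmallG

/-- ★★ **hTop FOR A SEGMENT ON `SU(2)`, exp-mean-log average, RANGE `L^{d−1} ≤ 400` (T³: `L400`).**  Standing range `j + n ≤ m + K`; `δ′` with `h(δ′) ≠ 0`;
activity ratio `W := K · h(1∕3+δ′)^{L^{d−1}−1} ∕ h(δ′)` with `K = (ofReal m(1∕400))⁻¹ + 1` VERBATIM the (H_K) constant of ✓`fibre_law_le_su2_record` (w8's hypothesis-free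
✓`hw_su2_of_pow_le_four_hundred`); the two smallness rows at `x := 2·W.toReal` for some `y ∈ (0,1]`, `θ₀ < 1`.  Then
**`(dU_j).map (iterFrom (blockAvg expMeanLogSU) j n) ≤ ofReal (exp (#PBond(j+n)·(2∕(1−θ₀))·(x ∕ y^{(2d−1)(L−1)}))) • dU_{j+n}`** — px8's ✓`map_iterFrom_le_exp_smul_of_hw` ∘
✓`exists_traj` at this `hw`. The per-`L` smallness numerals on `8 ≤ L ≤ 20` are NOT in the tree yet ((C′)∕H's job); this row is the kinematic half only. [cite: Balaban1987RG1, (0.4) p.253; Balaban1985UV3, (2) p.256] -/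
theorem map_iterFrom_le_exp_smul_su2_record (hjn : j + n ≤ P.m + P.K) (hL : P.L ^ (P.d - 1) ≤ 400) (δ' : ℝ)
    (hh0 : (HaarData.haar : Measure (Matrix.specialUnitaryGroup (Fin 2) ℂ)) {g | dist1 g < δ'} ≠ 0)
    {y θ₀ : ℝ} (hy : 0 < y) (hy1 : y ≤ 1) (hθ₀ : θ₀ < 1)
    (hsmallE : (1 + 2 / (1 - θ₀) * (2 *
        (((ENNReal.ofReal (((1 / 400 : ℝ) * Real.sin 1 * (Real.sin (Real.pi / 3) / (Real.pi / 3))) ^ 3 * (Real.sin (Real.pi / 3) / (Real.pi / 3)) ^ 2))⁻¹ + 1) *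
          ((HaarData.haar : Measure (Matrix.specialUnitaryGroup (Fin 2) ℂ)) {g | dist1 g < 1 / 3 + δ'} ^ (P.L ^ (P.d - 1) - 1) /
            (HaarData.haar : Measure (Matrix.specialUnitaryGroup (Fin 2) ℂ)) {g | dist1 g < δ'})).toReal /
        y ^ ((2 * P.d - 1) * (P.L - 1)))) ^ (2 * P.d * P.L ^ P.d) ≤ 2)
    (hsmallG : (y + 2 / (1 - θ₀) * (2 *
        (((ENNReal.ofReal (((1 / 400 : ℝ) * Real.sin 1 * (Real.sin (Real.pi / 3) / (Real.pi / 3))) ^ 3 * (Real.sin (Real.pi / 3) / (Real.pi / 3)) ^ 2))⁻¹ + 1) *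
          ((HaarData.haar : Measure (Matrix.specialUnitaryGroup (Fin 2) ℂ)) {g | dist1 g < 1 / 3 + δ'} ^ (P.L ^ (P.d - 1) - 1) /
            (HaarData.haar : Measure (Matrix.specialUnitaryGroup (Fin 2) ℂ)) {g | dist1 g < δ'})).toReal /
        y ^ ((2 * P.d - 1) * (P.L - 1)))) ^ (P.L - 1) *
      (1 + 2 * (2 *
        (((ENNReal.ofReal (((1 / 400 : ℝ) * Real.sin 1 * (Real.sin (Real.pi / 3) / (Real.pi / 3))) ^ 3 * (Real.sin (Real.pi / 3) / (Real.pi / 3)) ^ 2))⁻¹ + 1) *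
          ((HaarData.haar : Measure (Matrix.specialUnitaryGroup (Fin 2) ℂ)) {g | dist1 g < 1 / 3 + δ'} ^ (P.L ^ (P.d - 1) - 1) /
            (HaarData.haar : Measure (Matrix.specialUnitaryGroup (Fin 2) ℂ)) {g | dist1 g < δ'})).toReal /
        y ^ ((2 * P.d - 1) * (P.L - 1))) / y) ^ ((P.L - 1) * (2 * P.d)) ≤ θ₀) :
    (fieldMeasure P j (Matrix.specialUnitaryGroup (Fin 2) ℂ)).map
        (iterFrom (fun k => blockAvg (P := P) (j := k) (expMeanLogSU : LoopAverage (Matrix.specialUnitaryGroup (Fin 2) ℂ))) j n) ≤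
      ENNReal.ofReal (Real.exp (Fintype.card (PBond P (j + n)) * (2 / (1 - θ₀) * (2 *
        (((ENNReal.ofReal (((1 / 400 : ℝ) * Real.sin 1 * (Real.sin (Real.pi / 3) / (Real.pi / 3))) ^ 3 * (Real.sin (Real.pi / 3) / (Real.pi / 3)) ^ 2))⁻¹ + 1) *
          ((HaarData.haar : Measure (Matrix.specialUnitaryGroup (Fin 2) ℂ)) {g | dist1 g < 1 / 3 + δ'} ^ (P.L ^ (P.d - 1) - 1) /
            (HaarData.haar : Measure (Matrix.specialUnitaryGroup (Fin 2) ℂ)) {g | dist1 g < δ'})).toReal /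
        y ^ ((2 * P.d - 1) * (P.L - 1)))))) •
        fieldMeasure P (j + n) (Matrix.specialUnitaryGroup (Fin 2) ℂ) := by
  obtain ⟨V, hV0, hVs⟩ := exists_traj (P := P) (expMeanLogSU : LoopAverage (Matrix.specialUnitaryGroup (Fin 2) ℂ)) j n
  exact map_iterFrom_le_exp_smul_of_hw (expMeanLogSU : LoopAverage (Matrix.specialUnitaryGroup (Fin 2) ℂ)) j n measurable_expMeanLogSU_E V hV0 hVs hjn
    (weight_base_ne_top one_le_kstar_four_hundred_and_ne_top.2 (1 / 3 + δ') δ' (P.L ^ (P.d - 1) - 1) hh0)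
    (hw_su2_of_pow_le_four_hundred n V hV0 hVs hjn hL δ' hh0) hy hy1 hθ₀ hsmallE hsmallG

end Summit.QuantumFields.YangMills.Theorems.UV3BranchExpansionHTopSegmentSU2Ranges

end
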